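import Mathlib
import HarnessLib
import Literature.Computability.AlgebraicComplexity.PatternExpressions
import Literature.Computability.AlgebraicComplexity.DiPatternExpressions
import Literature.Combinatorics.SimpleGraph.TreeDecomposition
import Literature.Combinatorics.SimpleGraph.TreewidthBrambleLowerBound
import Summits.ValiantsHypothesis.ValiantsHypothesis.Theorems.MonotoneRestorationOrbitCompressionQPDiHomSpan
import Summits.ValiantsHypothesis.ValiantsHypothesis.Theorems.MonotoneRestorationOrbitRestorationLinearVolumeQPHomPolyBasics

/-!
# Route MonotoneRestoration — aside `OrbitRestorationLinearVolumeQP` (stmt-ValiantsHypothesis-18294):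
# SUB-THRESHOLD DESCENT, part 1/3 — tools (homogeneity, transport, isolated vertices, orientation)

The registered line `birth` of R1 = `OrbitRestorationLinearVolumeQP` rests on `stub_lvNarrowSpan` (BIPARTITE narrow span),
while the crux itself is equivalent to ONE-SORTED narrowness (`…LinearVolumeQPDiNarrowTight`); the converse passage
"one-sorted narrow + matrix-symmetric ⟹ bipartitely narrow" (DESCENT) is the VH-free residue between the line and the
crux, recorded as OPEN in `…OrbitCompressionQPTwoSortedPassage{,Sparse}.lean` and `…LinearVolumeQPNarrowSpanToDiNarrow.lean`.
Parts 2/3 (`…SubThresholdDescentExchange.lean`) and 3/3 (`…SubThresholdDescent.lean`) prove descent ON THE NOSE (no loss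
in the width) below the injective threshold `2 · deg ≤ n`.  This file supplies the bookkeeping:

* `isHomogeneous_diHomPoly` — `dihom_{D,n}` is homogeneous of degree `|D|`;
* `treewidth_le_of_map_injective`, `treewidth_map_equiv`, `diHomPoly_map_equiv` — pushing a one-sorted pattern forward
  along an injective (resp. bijective) vertex map does not lower (resp. preserves) the treewidth of its pattern graph
  `fromRel {(e.1, e.2)}`, and a bijection preserves `dihom`;
* `diHomPoly_map_subtype`, `exists_eraseIsolated`, `card_nonIsolated_le` — ISOLATED VERTICES RESCALE: every pattern is
  the push-forward of a pattern without isolated vertices on its `≤ 2|D|` non-isolated vertices, `dihom = n^{#isolated}·dihom`;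
* `fromRel_bipartite_eq_orient`, `homPoly_map_subtype`, `exists_eraseIsolated₂`, `card_nonIsolated_rows_le`,
  `card_nonIsolated_cols_le` — the same for bipartite patterns, and the pattern graph of a bipartite pattern IS the pattern
  graph of its orientation;
* `diHomPoly_orientFin`, `treewidth_orientFin`, `orientFin_noIsolated` — the orientation of a bipartite pattern on
  `Fin r ⊔ Fin c`, transported to `Fin (r + c)`: same polynomial (`diHomPoly_orient_eq_homPoly`), same treewidth, no
  isolated vertices if the bipartite pattern has none.

(Route-independent: no `Theses` import.)  Def-free helper (`--supports stmt-ValiantsHypothesis-18294`); nothing here is a named fact; VP ≠ VNP is not moved.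
References: Dawar–Pago–Seppelt 2025 (arXiv:2502.06740) Remark p. 17, §7 p. 45; Dwivedi–Pago–Seppelt 2026
(arXiv:2601.09343) eq. (1), Lemma 8.18.
-/

noncomputable section

open scoped Classical

-- `Summit.ValiantsHypothesis.ValiantsHypothesis.…` is the tree's single-conjunct layout (Sub = Summit).
set_option linter.dupNamespace false

namespace Summit.ValiantsHypothesis.ValiantsHypothesis.Theorems.SubThresholdDescent

open Literature.Computability.AlgebraicComplexity MvPolynomial
open Literature.Combinatorics.SimpleGraph (treewidth treewidth_le_of_hom_injective)
open Summit.ValiantsHypothesis.ValiantsHypothesis.Theorems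

/-! ### Homogeneity, transport and isolated vertices for one-sorted patterns -/

/-- `dihom_{D,n}` is homogeneous of degree `|D|`. [folklore] -/
theorem isHomogeneous_diHomPoly {V : Type} [Fintype V] [DecidableEq V] (D : Multiset (V × V)) (n : ℕ) :
    (diHomPoly D n ℂ).IsHomogeneous (Multiset.card D) := by
  unfold diHomPoly
  exact IsHomogeneous.sum _ _ _ fun h _ =>
    HomPolyBasics.isHomogeneous_prod_map_X (fun e : V × V => (h e.1, h e.2)) D

/-- Pushing a one-sorted pattern forward along an INJECTIVE vertex map embeds its pattern graph, so the
treewidth does not go down. [folklore] -/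
theorem treewidth_le_of_map_injective {V W : Type} [Fintype V] [DecidableEq V] [Fintype W]
    [DecidableEq W] (D : Multiset (V × V)) (f : V → W) (hf : Function.Injective f) :
    treewidth (SimpleGraph.fromRel fun u v : V => ∃ e ∈ D, u = e.1 ∧ v = e.2) ≤
      treewidth (SimpleGraph.fromRel fun u v : W =>
        ∃ e ∈ D.map (fun e => (f e.1, f e.2)), u = e.1 ∧ v = e.2) := by
  refine treewidth_le_of_hom_injective
    (G := SimpleGraph.fromRel fun u v : V => ∃ e ∈ D, u = e.1 ∧ v = e.2) ⟨f, fun {u v} huv => ?_⟩ hf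
  rw [SimpleGraph.fromRel_adj] at huv ⊢
  refine ⟨hf.ne huv.1, ?_⟩
  rcases huv.2 with ⟨e, he, rfl, rfl⟩ | ⟨e, he, rfl, rfl⟩
  · exact Or.inl ⟨(f e.1, f e.2), Multiset.mem_map_of_mem _ he, rfl, rfl⟩
  · exact Or.inr ⟨(f e.1, f e.2), Multiset.mem_map_of_mem _ he, rfl, rfl⟩

/-- Relabelling a one-sorted pattern along a bijection does not change the treewidth of its pattern
graph. [folklore] -/
theorem treewidth_map_equiv {V W : Type} [Fintype V] [DecidableEq V] [Fintype W] [DecidableEq W]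
    (D : Multiset (V × V)) (f : V ≃ W) :
    treewidth (SimpleGraph.fromRel fun u v : W =>
        ∃ e ∈ D.map (fun e => (f e.1, f e.2)), u = e.1 ∧ v = e.2) =
      treewidth (SimpleGraph.fromRel fun u v : V => ∃ e ∈ D, u = e.1 ∧ v = e.2) := by
  refine le_antisymm ?_ (treewidth_le_of_map_injective D f f.injective)
  have h := treewidth_le_of_map_injective (D.map fun e => (f e.1, f e.2)) f.symm f.symm.injective
  have hD : (D.map fun e => (f e.1, f e.2)).map (fun e => (f.symm e.1, f.symm e.2)) = D := by
    simp only [Multiset.map_map, Function.comp_def, Equiv.symm_apply_apply, Prod.mk.eta, Multiset.map_id']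
  rwa [hD] at h

/-- Relabelling a one-sorted pattern along a bijection does not change its homomorphism polynomial.
[folklore] -/
theorem diHomPoly_map_equiv {V W : Type} [Fintype V] [DecidableEq V] [Fintype W] [DecidableEq W]
    (D : Multiset (V × V)) (f : V ≃ W) (n : ℕ) :
    diHomPoly (D.map fun e => (f e.1, f e.2)) n ℂ = diHomPoly D n ℂ := by
  unfold diHomPoly
  exact DiHomSpan.diHom_map_equiv D f n

/-- **Isolated vertices rescale** (one-sorted): the pattern on `V` whose edges are those of a pattern
on the subtype `{v // P v}` has `dihom = n^{#{v // ¬ P v}} · dihom`. [folklore] -/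
theorem diHomPoly_map_subtype {V : Type} [Fintype V] [DecidableEq V] (P : V → Prop) [DecidablePred P]
    (D : Multiset ({v // P v} × {v // P v})) (n : ℕ) :
    diHomPoly (D.map fun e => ((e.1 : V), (e.2 : V))) n ℂ =
      (n ^ Fintype.card {v // ¬ P v}) • diHomPoly D n ℂ := by
  unfold diHomPoly
  simp only [Multiset.map_map, Function.comp_def]
  have step : (∑ h : V → Fin n,
      (D.map fun e => (X (h (e.1 : V), h (e.2 : V)) : MvPolynomial (Fin n × Fin n) ℂ)).prod) =
      ∑ gc : ({v // P v} → Fin n) × ({v // ¬ P v} → Fin n),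
        (D.map fun e => (X (gc.1 e.1, gc.1 e.2) : MvPolynomial (Fin n × Fin n) ℂ)).prod :=
    Fintype.sum_equiv (Equiv.piEquivPiSubtypeProd P fun _ : V => Fin n) _ _ (fun h => rfl)
  rw [step, Fintype.sum_prod_type_right]
  dsimp only
  rw [Finset.sum_const, Finset.card_univ, Fintype.card_fun, Fintype.card_fin]

/-- Every one-sorted pattern is the push-forward of a pattern WITHOUT ISOLATED VERTICES on the subtype
of its non-isolated vertices. [folklore] -/
theorem exists_eraseIsolated {V : Type} [Fintype V] [DecidableEq V] (D : Multiset (V × V)) :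
    ∃ D' : Multiset ({v // ∃ e ∈ D, e.1 = v ∨ e.2 = v} × {v // ∃ e ∈ D, e.1 = v ∨ e.2 = v}),
      D'.map (fun e => ((e.1 : V), (e.2 : V))) = D ∧
      (∀ u, ∃ e ∈ D', e.1 = u ∨ e.2 = u) ∧ Multiset.card D' = Multiset.card D := by
  refine ⟨D.attach.map fun x => (⟨x.1.1, x.1, x.2, Or.inl rfl⟩, ⟨x.1.2, x.1, x.2, Or.inr rfl⟩),
    ?_, ?_, by simp⟩
  · simp only [Multiset.map_map, Function.comp_def, Prod.mk.eta, Multiset.attach_map_val]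
  · rintro ⟨u, e, he, hu⟩
    refine ⟨(⟨e.1, e, he, Or.inl rfl⟩, ⟨e.2, e, he, Or.inr rfl⟩),
      Multiset.mem_map.2 ⟨⟨e, he⟩, Multiset.mem_attach _ _, rfl⟩, ?_⟩
    rcases hu with rfl | rfl
    · exact Or.inl rfl
    · exact Or.inr rfl

/-- The non-isolated vertices of a one-sorted pattern are at most twice its number of edges.
[folklore] -/
theorem card_nonIsolated_le {V : Type} [Fintype V] [DecidableEq V] (D : Multiset (V × V)) :
    Fintype.card {v // ∃ e ∈ D, e.1 = v ∨ e.2 = v} ≤ 2 * Multiset.card D := by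
  rw [Fintype.card_subtype]
  calc (Finset.univ.filter fun v : V => ∃ e ∈ D, e.1 = v ∨ e.2 = v).card
      ≤ ((D.map Prod.fst).toFinset ∪ (D.map Prod.snd).toFinset).card := by
        refine Finset.card_le_card fun v hv => ?_
        obtain ⟨e, he, h⟩ := (Finset.mem_filter.1 hv).2
        rcases h with rfl | rfl
        · exact Finset.mem_union_left _ (Multiset.mem_toFinset.2 (Multiset.mem_map_of_mem _ he))
        · exact Finset.mem_union_right _ (Multiset.mem_toFinset.2 (Multiset.mem_map_of_mem _ he))
    _ ≤ (D.map Prod.fst).toFinset.card + (D.map Prod.snd).toFinset.card := Finset.card_union_le _ _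
    _ ≤ Multiset.card (D.map Prod.fst) + Multiset.card (D.map Prod.snd) :=
        Nat.add_le_add (Multiset.toFinset_card_le _) (Multiset.toFinset_card_le _)
    _ = 2 * Multiset.card D := by rw [Multiset.card_map, Multiset.card_map]; ring

/-! ### Bipartite patterns: orientation and isolated vertices -/

/-- The pattern graph of a bipartite pattern IS the pattern graph of its orientation (every edge
directed from its row end to its column end). [folklore] -/
theorem fromRel_bipartite_eq_orient {a b : ℕ} (F : Multiset (Fin a × Fin b)) :
    (SimpleGraph.fromRel fun u v : Fin a ⊕ Fin b => ∃ e ∈ F, u = Sum.inl e.1 ∧ v = Sum.inr e.2) =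
      SimpleGraph.fromRel fun u v : Fin a ⊕ Fin b =>
        ∃ e ∈ F.map (fun e => ((Sum.inl e.1 : Fin a ⊕ Fin b), (Sum.inr e.2 : Fin a ⊕ Fin b))),
          u = e.1 ∧ v = e.2 := by
  have hr : (fun u v : Fin a ⊕ Fin b => ∃ e ∈ F, u = Sum.inl e.1 ∧ v = Sum.inr e.2) =
      fun u v : Fin a ⊕ Fin b =>
        ∃ e ∈ F.map (fun e => ((Sum.inl e.1 : Fin a ⊕ Fin b), (Sum.inr e.2 : Fin a ⊕ Fin b))),
          u = e.1 ∧ v = e.2 := by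
    funext u v
    apply propext
    constructor
    · rintro ⟨e, he, rfl, rfl⟩
      exact ⟨_, Multiset.mem_map_of_mem _ he, rfl, rfl⟩
    · rintro ⟨d, hd, rfl, rfl⟩
      obtain ⟨e, he, rfl⟩ := Multiset.mem_map.1 hd
      exact ⟨e, he, rfl, rfl⟩
  rw [hr]

/-- **Isolated vertices rescale** (bipartite): the pattern on `A ⊔ B` whose edges are those of a pattern
on the subtypes `{i // P i} ⊔ {j // Q j}` has `hom = n^{#¬P} · n^{#¬Q} · hom`. [folklore] -/
theorem homPoly_map_subtype {A B : Type} [Fintype A] [DecidableEq A] [Fintype B] [DecidableEq B]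
    (P : A → Prop) [DecidablePred P] (Q : B → Prop) [DecidablePred Q]
    (F : Multiset ({i // P i} × {j // Q j})) (n : ℕ) :
    homPoly (F.map fun e => ((e.1 : A), (e.2 : B))) n ℂ =
      (n ^ Fintype.card {i // ¬ P i} * n ^ Fintype.card {j // ¬ Q j}) • homPoly F n ℂ := by
  unfold homPoly
  simp only [Multiset.map_map, Function.comp_def]
  have step : (∑ h : (A → Fin n) × (B → Fin n),
      (F.map fun e => (X (h.1 (e.1 : A), h.2 (e.2 : B)) : MvPolynomial (Fin n × Fin n) ℂ)).prod) =
      ∑ gc : (({i // P i} → Fin n) × ({j // Q j} → Fin n)) ×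
          (({i // ¬ P i} → Fin n) × ({j // ¬ Q j} → Fin n)),
        (F.map fun e => (X (gc.1.1 e.1, gc.1.2 e.2) : MvPolynomial (Fin n × Fin n) ℂ)).prod :=
    Fintype.sum_equiv (((Equiv.piEquivPiSubtypeProd P fun _ : A => Fin n).prodCongr
      (Equiv.piEquivPiSubtypeProd Q fun _ : B => Fin n)).trans
      (Equiv.prodProdProdComm _ _ _ _)) _ _ (fun h => rfl)
  rw [step, Fintype.sum_prod_type_right]
  dsimp only
  rw [Finset.sum_const, Finset.card_univ, Fintype.card_prod, Fintype.card_fun, Fintype.card_fun,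
    Fintype.card_fin]

/-- Every bipartite pattern is the push-forward of a pattern WITHOUT ISOLATED VERTICES on the subtypes of
its non-isolated row and column vertices. [folklore] -/
theorem exists_eraseIsolated₂ {A B : Type} [Fintype A] [DecidableEq A] [Fintype B] [DecidableEq B]
    (F : Multiset (A × B)) :
    ∃ F' : Multiset ({i // ∃ e ∈ F, e.1 = i} × {j // ∃ e ∈ F, e.2 = j}),
      F'.map (fun e => ((e.1 : A), (e.2 : B))) = F ∧
      (∀ i, ∃ e ∈ F', e.1 = i) ∧ (∀ j, ∃ e ∈ F', e.2 = j) ∧ Multiset.card F' = Multiset.card F := by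
  refine ⟨F.attach.map fun x => (⟨x.1.1, x.1, x.2, rfl⟩, ⟨x.1.2, x.1, x.2, rfl⟩), ?_, ?_, ?_, by simp⟩
  · simp only [Multiset.map_map, Function.comp_def, Prod.mk.eta, Multiset.attach_map_val]
  · rintro ⟨i, e, he, rfl⟩
    exact ⟨_, Multiset.mem_map.2 ⟨⟨e, he⟩, Multiset.mem_attach _ _, rfl⟩, rfl⟩
  · rintro ⟨j, e, he, rfl⟩
    exact ⟨_, Multiset.mem_map.2 ⟨⟨e, he⟩, Multiset.mem_attach _ _, rfl⟩, rfl⟩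

/-- The non-isolated row vertices of a bipartite pattern are at most its number of edges. [folklore] -/
theorem card_nonIsolated_rows_le {A B : Type} [Fintype A] [DecidableEq A] [Fintype B] [DecidableEq B]
    (F : Multiset (A × B)) : Fintype.card {i // ∃ e ∈ F, e.1 = i} ≤ Multiset.card F := by
  rw [Fintype.card_subtype]
  calc (Finset.univ.filter fun i : A => ∃ e ∈ F, e.1 = i).card
      ≤ (F.map Prod.fst).toFinset.card := by
        refine Finset.card_le_card fun i hi => ?_
        obtain ⟨e, he, rfl⟩ := (Finset.mem_filter.1 hi).2
        exact Multiset.mem_toFinset.2 (Multiset.mem_map_of_mem _ he)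
    _ ≤ Multiset.card (F.map Prod.fst) := Multiset.toFinset_card_le _
    _ = Multiset.card F := Multiset.card_map _ _

/-- The non-isolated column vertices of a bipartite pattern are at most its number of edges.
[folklore] -/
theorem card_nonIsolated_cols_le {A B : Type} [Fintype A] [DecidableEq A] [Fintype B] [DecidableEq B]
    (F : Multiset (A × B)) : Fintype.card {j // ∃ e ∈ F, e.2 = j} ≤ Multiset.card F := by
  rw [Fintype.card_subtype]
  calc (Finset.univ.filter fun j : B => ∃ e ∈ F, e.2 = j).card
      ≤ (F.map Prod.snd).toFinset.card := by
        refine Finset.card_le_card fun j hj => ?_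
        obtain ⟨e, he, rfl⟩ := (Finset.mem_filter.1 hj).2
        exact Multiset.mem_toFinset.2 (Multiset.mem_map_of_mem _ he)
    _ ≤ Multiset.card (F.map Prod.snd) := Multiset.toFinset_card_le _
    _ = Multiset.card F := Multiset.card_map _ _



/-! ### The orientation of a bipartite pattern, transported to `Fin (r + c)` -/


/-- The orientation of a bipartite pattern on `Fin r ⊔ Fin c` (every edge directed row → column), transported
to the vertex type `Fin (r + c)`, is a one-sorted pattern with the SAME homomorphism polynomial
(`diHomPoly_orient_eq_homPoly` + relabelling). [folklore] -/
theorem diHomPoly_orientFin {r c : ℕ} (F : Multiset (Fin r × Fin c)) (n : ℕ) :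
    diHomPoly ((F.map fun e => ((Sum.inl e.1 : Fin r ⊕ Fin c), (Sum.inr e.2 : Fin r ⊕ Fin c))).map
        fun e => (finSumFinEquiv e.1, finSumFinEquiv e.2)) n ℂ = homPoly F n ℂ := by
  rw [diHomPoly_map_equiv]
  -- (as in `OrbitRestorationLinearVolumeQPDiNarrow.diHomPoly_orient_eq_homPoly`, re-proved here to keep this
  -- file outside the cone of the route file)
  unfold diHomPoly homPoly
  refine Fintype.sum_equiv (Equiv.sumArrowEquivProdArrow (Fin r) (Fin c) (Fin n)) _ _ fun h => ?_
  simp only [Multiset.map_map, Function.comp_def, Equiv.sumArrowEquivProdArrow_apply_fst,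
    Equiv.sumArrowEquivProdArrow_apply_snd]

/-- The transported orientation of a bipartite pattern has the SAME treewidth as the bipartite pattern graph. [folklore] -/
theorem treewidth_orientFin {r c : ℕ} (F : Multiset (Fin r × Fin c)) :
    treewidth (SimpleGraph.fromRel fun u v : Fin (r + c) =>
        ∃ e ∈ ((F.map fun e => ((Sum.inl e.1 : Fin r ⊕ Fin c), (Sum.inr e.2 : Fin r ⊕ Fin c))).map
          fun e => (finSumFinEquiv e.1, finSumFinEquiv e.2)), u = e.1 ∧ v = e.2) =
      treewidth (SimpleGraph.fromRel fun u v : Fin r ⊕ Fin c =>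
        ∃ e ∈ F, u = Sum.inl e.1 ∧ v = Sum.inr e.2) := by
  rw [treewidth_map_equiv, fromRel_bipartite_eq_orient]

/-- The transported orientation of a bipartite pattern without isolated rows and columns has no isolated vertices. [folklore] -/
theorem orientFin_noIsolated {r c : ℕ} (F : Multiset (Fin r × Fin c))
    (hrow : ∀ u : Fin r, ∃ e ∈ F, e.1 = u) (hcol : ∀ v : Fin c, ∃ e ∈ F, e.2 = v) :
    ∀ u : Fin (r + c), ∃ e ∈ ((F.map fun e => ((Sum.inl e.1 : Fin r ⊕ Fin c),
        (Sum.inr e.2 : Fin r ⊕ Fin c))).map fun e => (finSumFinEquiv e.1, finSumFinEquiv e.2)),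
      e.1 = u ∨ e.2 = u := by
  intro u
  obtain ⟨x, rfl⟩ := finSumFinEquiv.surjective u
  rcases x with i | j
  · obtain ⟨e, he, rfl⟩ := hrow i
    exact ⟨_, Multiset.mem_map_of_mem _ (Multiset.mem_map_of_mem _ he), Or.inl rfl⟩
  · obtain ⟨e, he, rfl⟩ := hcol j
    exact ⟨_, Multiset.mem_map_of_mem _ (Multiset.mem_map_of_mem _ he), Or.inr rfl⟩

end Summit.ValiantsHypothesis.ValiantsHypothesis.Theorems.SubThresholdDescent

end
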